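import Literature.MathematicalPhysics.QuantumLattice.HubbardOneParticleCost
import Literature.MathematicalPhysics.QuantumLattice.HubbardHubbardModelEtaPairingProofs
import HarnessLib

/-!
# Route `JosephsonMirror` — removing two electrons costs `O(1)` (crux `JmCusp`, line `Sketch`)

Support lemma for the crux item stmt-HubbardSuperconductivity-2228 (`JmCusp`) of route
`JosephsonMirror` (sub-problem `HubbardSuperconductivity`), stub `stub_sectorGap` of the checked
line `Sketch`: for the Hubbard Hamiltonian `H = hubbardTorus 2 L 1 U` on the `L × L` torus at the
filling `N_L = 2n`, `n = ⌊(1 - δ) L² / 2⌋₊`, `δ ∈ (0, 1/2)`, the lowest energy of the joint sector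
`(N_L - 2, S^z = 0)` exceeds the lowest energy of `(N_L, S^z = 0)` by at most a constant
`C = C(U)`, uniformly in `L ≥ 4`:

  `minEnergyOn H (N_L - 2, 0) ≤ minEnergyOn H (N_L, 0) + 24 K`, `K = 9 · 2 (2|1| + |U|)`.

Proof (all ingredients are in the Literature tree): by `SU(2)` the `S^z = 0` sector floors are the
`N`-particle ground-state energies `E(2n)`, `E(2n - 2)` (`groundEnergyAt_eq_minEnergyOn_szSector`,
Lieb 1989: every spin multiplet is represented at `S^z = 0`); the volume-uniform one-particle
removal cost `E(N - 1) ≤ E(N) + K · 2|Λ| / N` with `K = 2 (2Δ + 1)(2|t| + |U|)`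
(`ThermodynamicLimit.groundEnergyAt_pred_le`; degree `Δ = 4` on the torus,
`SourceGas.card_filter_fermionTorusGraph_adj_le`; `t = 1`, `|Λ| = L²`) is applied at `N = 2n` and
at `N = 2n - 1`; and `L² ≤ 8 n` for `L ≥ 4` bounds the two weights `2L²/(2n) ≤ 8`,
`2L²/(2n - 1) ≤ 16`.

Sources: D. Ruelle, *Statistical Mechanics: Rigorous Results* (1969), §3.4 (a priori bounds and
continuity of thermodynamic functions in the density); E. H. Lieb, Phys. Rev. Lett. 62 (1989)
1201, proof of Theorem 1 (the `S^z = 0` sector carries the ground-state energy); H. Tasaki,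
*Physics and Mathematics of Quantum Many-Body Systems* (2020), §2.1. No new definitions.
-/

-- the mandated namespace `Summit.<Summit>.<Problem>.Theorems` repeats `HubbardSuperconductivity`
-- (single-problem summit, D-0017), which the `dupNamespace` linter flags on every declaration
set_option linter.dupNamespace false

namespace Summit.HubbardSuperconductivity.HubbardSuperconductivity.Theorems.JosephsonMirror

open Matrix Literature.MathematicalPhysics.QuantumLattice

/-- **Arithmetic of the filling.** For `δ ∈ (0, 1/2)` and `L ≥ 4` the half filling number
`n = ⌊(1 - δ) L² / 2⌋₊` satisfies `1 ≤ n ≤ L²` and `L² ≤ 8 n` (since `1 - δ > 1/2` gives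
`n > L²/4 - 1 ≥ L²/8 + 1`). [folklore] -/
theorem filling_floor_bounds {δ : ℝ} (hδ : δ ∈ Set.Ioo (0:ℝ) (1 / 2)) {L : ℕ} (hL : 4 ≤ L) :
    1 ≤ ⌊(1 - δ) * (L : ℝ) ^ 2 / 2⌋₊ ∧ ⌊(1 - δ) * (L : ℝ) ^ 2 / 2⌋₊ ≤ L ^ 2 ∧
      (L : ℝ) ^ 2 ≤ 8 * (⌊(1 - δ) * (L : ℝ) ^ 2 / 2⌋₊ : ℝ) := by
  have hL' : (4 : ℝ) ≤ L := by exact_mod_cast hL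
  have hL2 : (16 : ℝ) ≤ (L : ℝ) ^ 2 := by nlinarith
  have hδ2 : (1 / 2 : ℝ) ≤ 1 - δ := by linarith [hδ.2]
  have hδ1 : 1 - δ ≤ 1 := by linarith [hδ.1]
  have h8 : (1 / 2 : ℝ) * (L : ℝ) ^ 2 ≤ (1 - δ) * (L : ℝ) ^ 2 :=
    mul_le_mul_of_nonneg_right hδ2 (by positivity)
  have h1 : (1 - δ) * (L : ℝ) ^ 2 ≤ 1 * (L : ℝ) ^ 2 :=
    mul_le_mul_of_nonneg_right hδ1 (by positivity)
  have hlt := Nat.lt_floor_add_one ((1 - δ) * (L : ℝ) ^ 2 / 2)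
  refine ⟨Nat.le_floor ?_, Nat.floor_le_of_le ?_, ?_⟩
  · rw [Nat.cast_one, le_div_iff₀ (by norm_num : (0 : ℝ) < 2)]
    linarith
  · rw [div_le_iff₀ (by norm_num : (0 : ℝ) < 2)]
    push_cast
    linarith
  · linarith

/-- **Removing two electrons costs `O(1)`** (stub `stub_sectorGap` of line `Sketch`, crux `JmCusp`,
stmt-HubbardSuperconductivity-2228): for `δ ∈ (0, 1/2)` there are `C` and `L₀` such that for all
`L ≥ L₀`, with `N_L = 2 ⌊(1 - δ) L² / 2⌋₊` and `H = hubbardTorus 2 L 1 U`,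
`minEnergyOn H (szSector (N_L - 2) 0) ≤ minEnergyOn H (szSector N_L 0) + C`. Here
`C = 24 K`, `K = 9 · 2 (2|1| + |U|)`, `L₀ = 4`: the `S^z = 0` floors are the `N`-particle
ground-state energies (`SU(2)`, Lieb 1989), and the one-particle removal cost
`E(N - 1) ≤ E(N) + K · 2L² / N` (Ruelle 1969 §3.4, quantum lattice version
`ThermodynamicLimit.groundEnergyAt_pred_le`) is used at `N = 2n` and `N = 2n - 1` with
`L² ≤ 8n`. [folklore] -/
theorem minEnergyOn_szSector_sub_two_le_add_const (U δ : ℝ) (hδ : δ ∈ Set.Ioo (0:ℝ) (1 / 2)) :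
    ∃ C : ℝ, ∃ L₀ : ℕ, ∀ (L : ℕ) [NeZero L], L₀ ≤ L →
      (hubbardTorus 2 L 1 U).minEnergyOn (szSector (2 * ⌊(1 - δ) * (L : ℝ) ^ 2 / 2⌋₊ - 2) 0) ≤
        (hubbardTorus 2 L 1 U).minEnergyOn (szSector (2 * ⌊(1 - δ) * (L : ℝ) ^ 2 / 2⌋₊) 0) + C := by
  -- the one-particle cost constant `K = (2Δ + 1) · 2 (2|t| + |U|)` at `Δ = 4`, `t = 1`
  have hK0 : (0 : ℝ) ≤ ((2 * 4 + 1 : ℕ) : ℝ) * (2 * (2 * |(1 : ℝ)| + |U|)) := by positivity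
  set K : ℝ := ((2 * 4 + 1 : ℕ) : ℝ) * (2 * (2 * |(1 : ℝ)| + |U|))
  refine ⟨24 * K, 4, fun L _ hL => ?_⟩
  -- the filling `N_L = 2n`, `1 ≤ n ≤ L²`, `L² ≤ 8n`
  obtain ⟨hn1, hnL, hn8⟩ := filling_floor_bounds hδ hL
  set n : ℕ := ⌊(1 - δ) * (L : ℝ) ^ 2 / 2⌋₊
  have hV : (Fintype.card (FermionTorus 2 L) : ℝ) = (L : ℝ) ^ 2 := by
    rw [card_fermionTorus, Nat.cast_pow]
  have hnV : n ≤ Fintype.card (FermionTorus 2 L) := by rwa [card_fermionTorus]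
  have hn'V : n - 1 ≤ Fintype.card (FermionTorus 2 L) := (Nat.sub_le n 1).trans hnV
  -- degree `≤ 4` on the two-dimensional torus
  have hΔ : ∀ x : FermionTorus 2 L,
      (Finset.univ.filter fun y => (fermionTorusGraph 2 L).Adj x y).card ≤ 4 :=
    fun x => SourceGas.card_filter_fermionTorusGraph_adj_le x
  -- `SU(2)`: the `S^z = 0` floors are the `N`-particle ground-state energies
  have h₁ : groundEnergyAt (fermionTorusGraph 2 L) 1 U (2 * n) =
      (hubbardTorus 2 L 1 U).minEnergyOn (szSector (2 * n) 0) :=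
    groundEnergyAt_eq_minEnergyOn_szSector (fermionTorusGraph 2 L) 1 U hnV
  have h₂ : groundEnergyAt (fermionTorusGraph 2 L) 1 U (2 * (n - 1)) =
      (hubbardTorus 2 L 1 U).minEnergyOn (szSector (2 * (n - 1)) 0) :=
    groundEnergyAt_eq_minEnergyOn_szSector (fermionTorusGraph 2 L) 1 U hn'V
  -- the two one-particle removal costs `2n → 2n - 1 → 2n - 2`
  have e₁ : groundEnergyAt (fermionTorusGraph 2 L) 1 U (2 * n - 1) ≤
      groundEnergyAt (fermionTorusGraph 2 L) 1 U (2 * n) +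
        K * (2 * (Fintype.card (FermionTorus 2 L) : ℝ)) / ((2 * n : ℕ) : ℝ) :=
    ThermodynamicLimit.groundEnergyAt_pred_le (fermionTorusGraph 2 L) hΔ 1 U (N := 2 * n)
      (by omega) (by omega)
  have e₂ : groundEnergyAt (fermionTorusGraph 2 L) 1 U (2 * (n - 1)) ≤
      groundEnergyAt (fermionTorusGraph 2 L) 1 U (2 * n - 1) +
        K * (2 * (Fintype.card (FermionTorus 2 L) : ℝ)) / ((2 * n - 1 : ℕ) : ℝ) := by
    have h := ThermodynamicLimit.groundEnergyAt_pred_le (fermionTorusGraph 2 L) hΔ 1 U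
      (N := 2 * n - 1) (by omega) (by omega)
    rwa [show 2 * n - 1 - 1 = 2 * (n - 1) by omega] at h
  -- the weights `2L²/(2n) ≤ 8`, `2L²/(2n - 1) ≤ 16`
  have hn0 : (0 : ℝ) < ((2 * n : ℕ) : ℝ) := by exact_mod_cast (by omega : 0 < 2 * n)
  have hn0' : (0 : ℝ) < ((2 * n - 1 : ℕ) : ℝ) := by exact_mod_cast (by omega : 0 < 2 * n - 1)
  have hnn : (n : ℝ) ≤ ((2 * n - 1 : ℕ) : ℝ) := by exact_mod_cast (by omega : n ≤ 2 * n - 1)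
  have hKn : K * (L : ℝ) ^ 2 ≤ K * (8 * (n : ℝ)) := mul_le_mul_of_nonneg_left hn8 hK0
  have hKn' : K * (n : ℝ) ≤ K * ((2 * n - 1 : ℕ) : ℝ) := mul_le_mul_of_nonneg_left hnn hK0
  have w₁ : K * (2 * (Fintype.card (FermionTorus 2 L) : ℝ)) / ((2 * n : ℕ) : ℝ) ≤ 8 * K := by
    rw [div_le_iff₀ hn0, hV]
    push_cast
    linarith
  have w₂ : K * (2 * (Fintype.card (FermionTorus 2 L) : ℝ)) / ((2 * n - 1 : ℕ) : ℝ) ≤ 16 * K := by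
    rw [div_le_iff₀ hn0', hV]
    linarith
  -- assemble
  rw [show 2 * n - 2 = 2 * (n - 1) by omega, ← h₁, ← h₂]
  linarith

/-- **Stub `stub_sectorGap` of line `Sketch` (crux `JmCusp`, stmt-HubbardSuperconductivity-2228),
by its registered name and signature**: removing two electrons from the `(N_L, S^z = 0)` sector of
`hubbardTorus 2 L 1 U` costs `O(1)` uniformly in `L` — an alias of
`minEnergyOn_szSector_sub_two_le_add_const` (Ruelle 1969 §3.4; Lieb, PRL 62 (1989) 1201).
[folklore] -/
theorem stub_sectorGap (U δ : ℝ) (hδ : δ ∈ Set.Ioo (0:ℝ) (1 / 2)) :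
    ∃ C : ℝ, ∃ L₀ : ℕ, ∀ (L : ℕ) [NeZero L], L₀ ≤ L →
      (Literature.MathematicalPhysics.QuantumLattice.hubbardTorus 2 L 1 U).minEnergyOn
          (Literature.MathematicalPhysics.QuantumLattice.szSector (2 * ⌊(1 - δ) * (L : ℝ) ^ 2 / 2⌋₊ - 2) 0) ≤
        (Literature.MathematicalPhysics.QuantumLattice.hubbardTorus 2 L 1 U).minEnergyOn
          (Literature.MathematicalPhysics.QuantumLattice.szSector (2 * ⌊(1 - δ) * (L : ℝ) ^ 2 / 2⌋₊) 0) + C :=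
  minEnergyOn_szSector_sub_two_le_add_const U δ hδ

end Summit.HubbardSuperconductivity.HubbardSuperconductivity.Theorems.JosephsonMirror
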